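import Mathlib
import HarnessLib
import Literature.RepresentationTheory.CompactGroups.WeylIntegralFormula
import Summits.Ventures.LatticeQCDFlow.Exactness.SUNTorusBookedDensity
import Summits.Ventures.LatticeQCDFlow.Exactness.SpectralTorusBasics
import Summits.Ventures.LatticeQCDFlow.Exactness.SpectralDensityMeasurable

/-!
# The `SU(N)` spectral kernel and spectral coupling layer with the densities the engine books are exact transports of (product) Haar, every `N` — the bookkeeping hypotheses eliminated

HONEST FRAMING: exact (Metropolis-corrected) sampling algorithms for lattice gauge theory;
figures of merit are autocorrelation/cost numbers at stated couplings and volumes; no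
continuum-physics claim.

Venture `LatticeQCDFlow` (cell pub-lqcd), topic `Exactness`; FANOUT row 10 (`eng-equiv`, engine
`latflow.equiv` `SUNSpectralCoupling` general `N`: per active link the kernel books
`ldj = ld_cell + log_haar(x') − log_haar(x)`, a symmetric function of the eigen-phases; Boyda et al.,
PRD 103 (2021) 074504 §III–IV, App. B Algorithm 2).  NEW WORK of the cell: the every-`N` version of
`SU3SpectralCouplingLayerBooked.lean`, corollaries of `SUNTorusBookedDensity.lean` and
`SUNTorusAlcoveJacobian.lean`.  Nothing is cited as a fact; no number; no definition.

## What is typed (`x(θ) = Fin.snoc θ (−Σθ)`, `A = {x(θ) strictly increasing, x(θ)(last) < x(θ)(0) + 2π}`, `D(d) = |Δ(d)|²/(n+1)!`)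

* **`hasJacobian_spectralKernel_sun_booked`** — `f` MEASURABLE (no continuity),
  permutation-equivariant, given on the alcove by `G` (`G(A) ⊆ A`, `HasJacobian (Leb|_A) G JA`); ANY
  kernel `h` following the spectral recipe of `f`; ANY `J` (measurability is automatic, `measurable_of_spectral`) which is a
  symmetric measurable function `JD` of the spectrum with `JD(e^{ix(θ)}) D(e^{ix(θ)}) = JA(θ) D(e^{ix(Gθ)})`
  on `A`:  `HasJacobian (Haar SU(n+1)) h J`;
* **`hasJacobian_spectralCouplingLayer_sun_booked`** — the same per active link and frozen context:
  the `SU(n+1)` spectral coupling layer `Theory2.coupleFun p (u ↦ h a y (uS)(uS)⁻¹u)` has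
  `HasJacobian (⊗ Haar_{SU(n+1)}) _ (ofReal ∘ Theory2.coupleJac p (j at the loops))` with the BOOKED
  per-link densities `j a y` — nothing assumed beyond the architecture (continuity, equivariance,
  the cell flow's Jacobian on the alcove, and `j` = the booked symmetric function of the spectrum).

NOT here: the elimination of the measurability of `J`; the cell charts for `N ≥ 4`; any number.
-/

noncomputable section

namespace Summit.Ventures.LatticeQCDFlow.Exactness

open MeasureTheory Matrix Set Real
open Literature.LinearAlgebra.Matrix
open Literature.MathematicalPhysics.QuantumFieldTheory (haarProbability)
open Literature.RepresentationTheory.CompactGroups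
open scoped ENNReal

variable {n : ℕ}

section SUN

variable {E : (Fin n → ℝ) → specialDiagonalTorus (Fin (n + 1))}
  (hE : ∀ θ (i : Fin (n + 1)), (((E θ : specialDiagonalTorus (Fin (n + 1))) : Matrix.specialUnitaryGroup (Fin (n + 1)) ℂ) :
    Matrix (Fin (n + 1)) (Fin (n + 1)) ℂ) i i = (Circle.exp ((Fin.snoc θ (-∑ k, θ k) : Fin (n + 1) → ℝ) i) : ℂ))
  {P : Equiv.Perm (Fin (n + 1)) → specialDiagonalTorus (Fin (n + 1)) → specialDiagonalTorus (Fin (n + 1))}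
  (hP : ∀ σ t i,
    (((P σ t : specialDiagonalTorus (Fin (n + 1))) : Matrix.specialUnitaryGroup (Fin (n + 1)) ℂ) : Matrix (Fin (n + 1)) (Fin (n + 1)) ℂ) i i =
      ((t : Matrix.specialUnitaryGroup (Fin (n + 1)) ℂ) : Matrix (Fin (n + 1)) (Fin (n + 1)) ℂ) (σ i) (σ i))

include hE hP

/-- **The `SU(n+1)` spectral kernel with the booked density is an exact transport of Haar, every `N`.**  `f`
measurable (no continuity: the engine's `f` jumps across alcove walls), permutation-equivariant, given on the alcove `A` by a flow `G`
mapping `A` into `A` with `HasJacobian (Leb|_A) G JA`; `h` ANY kernel following the spectral recipe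
of `f` (`f` preserving unimodularity and unit product); `J` ANY density (measurable automatically) which is a symmetric
measurable function `JD` of the spectrum with the booked value on the alcove chart,
`JD(e^{ix(θ)}) · D(e^{ix(θ)}) = JA(θ) · D(e^{ix(Gθ)})`.  Then `HasJacobian (Haar SU(n+1)) h J`. -/
theorem hasJacobian_spectralKernel_sun_booked
    {f : (Fin (n + 1) → ℂ) → (Fin (n + 1) → ℂ)} (hfm : Measurable f)
    (hfperm : ∀ (σ : Equiv.Perm (Fin (n + 1))) (d : Fin (n + 1) → ℂ), (∀ i, ‖d i‖ = 1) →
      f (fun i => d (σ i)) = fun i => f d (σ i))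
    {G : (Fin n → ℝ) → (Fin n → ℝ)} {JA : (Fin n → ℝ) → ℝ≥0∞}
    (hG : HasJacobian ((volume : Measure (Fin n → ℝ)).restrict
      {θ : Fin n → ℝ | StrictMono (Fin.snoc θ (-∑ k, θ k) : Fin (n + 1) → ℝ) ∧
        (Fin.snoc θ (-∑ k, θ k) : Fin (n + 1) → ℝ) (Fin.last n) <
          (Fin.snoc θ (-∑ k, θ k) : Fin (n + 1) → ℝ) 0 + 2 * π}) G JA)
    (hGA : ∀ θ : Fin n → ℝ, StrictMono (Fin.snoc θ (-∑ k, θ k) : Fin (n + 1) → ℝ) →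
      (Fin.snoc θ (-∑ k, θ k) : Fin (n + 1) → ℝ) (Fin.last n) < (Fin.snoc θ (-∑ k, θ k) : Fin (n + 1) → ℝ) 0 + 2 * π →
      StrictMono (Fin.snoc (G θ) (-∑ k, (G θ) k) : Fin (n + 1) → ℝ) ∧
          (Fin.snoc (G θ) (-∑ k, (G θ) k) : Fin (n + 1) → ℝ) (Fin.last n) <
            (Fin.snoc (G θ) (-∑ k, (G θ) k) : Fin (n + 1) → ℝ) 0 + 2 * π)
    (hfG : ∀ θ : Fin n → ℝ, StrictMono (Fin.snoc θ (-∑ k, θ k) : Fin (n + 1) → ℝ) →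
      (Fin.snoc θ (-∑ k, θ k) : Fin (n + 1) → ℝ) (Fin.last n) < (Fin.snoc θ (-∑ k, θ k) : Fin (n + 1) → ℝ) 0 + 2 * π →
      f (fun i => (Circle.exp ((Fin.snoc θ (-∑ k, θ k) : Fin (n + 1) → ℝ) i) : ℂ)) =
        fun i => (Circle.exp ((Fin.snoc (G θ) (-∑ k, (G θ) k) : Fin (n + 1) → ℝ) i) : ℂ))
    {h : Matrix.specialUnitaryGroup (Fin (n + 1)) ℂ → Matrix.specialUnitaryGroup (Fin (n + 1)) ℂ}
    (hagree : ∀ (Q : Matrix.specialUnitaryGroup (Fin (n + 1)) ℂ) (V : Matrix (Fin (n + 1)) (Fin (n + 1)) ℂ) (d : Fin (n + 1) → ℂ),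
      V ∈ Matrix.unitaryGroup (Fin (n + 1)) ℂ → (Q : Matrix (Fin (n + 1)) (Fin (n + 1)) ℂ) = V * diagonal d * star V →
        ((h Q : Matrix.specialUnitaryGroup (Fin (n + 1)) ℂ) : Matrix (Fin (n + 1)) (Fin (n + 1)) ℂ) = V * diagonal (f d) * star V)
    (hf1 : ∀ d : Fin (n + 1) → ℂ, (∀ i, ‖d i‖ = 1) → ∀ i, ‖f d i‖ = 1)
    (hfdet : ∀ d : Fin (n + 1) → ℂ, (∀ i, ‖d i‖ = 1) → ∏ i, d i = 1 → ∏ i, f d i = 1)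
    {JD : (Fin (n + 1) → ℂ) → ℝ≥0∞} (hJDm : Measurable JD)
    (hJDperm : ∀ (σ : Equiv.Perm (Fin (n + 1))) (d : Fin (n + 1) → ℂ), JD (fun i => d (σ i)) = JD d)
    (hJchart : ∀ θ : Fin n → ℝ, StrictMono (Fin.snoc θ (-∑ k, θ k) : Fin (n + 1) → ℝ) →
      (Fin.snoc θ (-∑ k, θ k) : Fin (n + 1) → ℝ) (Fin.last n) < (Fin.snoc θ (-∑ k, θ k) : Fin (n + 1) → ℝ) 0 + 2 * π →
      JD (fun i => (Circle.exp ((Fin.snoc θ (-∑ k, θ k) : Fin (n + 1) → ℝ) i) : ℂ)) * ENNReal.ofReal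
          ((∏ i, ∏ k ∈ Finset.univ.erase i,
            ‖(Circle.exp ((Fin.snoc θ (-∑ k, θ k) : Fin (n + 1) → ℝ) i) : ℂ) -
              (Circle.exp ((Fin.snoc θ (-∑ k, θ k) : Fin (n + 1) → ℝ) k) : ℂ)‖) / (Fintype.card (Fin (n + 1))).factorial) =
        JA θ * ENNReal.ofReal
          ((∏ i, ∏ k ∈ Finset.univ.erase i,
            ‖(Circle.exp ((Fin.snoc (G θ) (-∑ k, (G θ) k) : Fin (n + 1) → ℝ) i) : ℂ) -
              (Circle.exp ((Fin.snoc (G θ) (-∑ k, (G θ) k) : Fin (n + 1) → ℝ) k) : ℂ)‖) /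
                (Fintype.card (Fin (n + 1))).factorial))
    {J : Matrix.specialUnitaryGroup (Fin (n + 1)) ℂ → ℝ≥0∞}
    (hJspec : ∀ (W : Matrix.specialUnitaryGroup (Fin (n + 1)) ℂ) (V : Matrix (Fin (n + 1)) (Fin (n + 1)) ℂ) (d : Fin (n + 1) → ℂ),
      V ∈ Matrix.unitaryGroup (Fin (n + 1)) ℂ → (W : Matrix (Fin (n + 1)) (Fin (n + 1)) ℂ) = V * diagonal d * star V → J W = JD d) :
    HasJacobian (haarProbability (Matrix.specialUnitaryGroup (Fin (n + 1)) ℂ)) h J := by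
  obtain ⟨fT, hfT⟩ := exists_torusMap_specialUnitary hf1 hfdet
  obtain ⟨Jf, hJfm, hJA, hJinv, hJ⟩ :=
    exists_torusDensity_sun_booked hE hP hfm hfperm hGA hfG hfT hJDm hJDperm hJchart hJspec
  exact hasJacobian_spectralKernel_sun_of_alcoveMap hE hP hfm hfperm hG hfG hagree hfT hJfm hJA hJinv
    (measurable_of_spectral hJDm hJspec) hJ

/-- **The `SU(n+1)` spectral coupling layer with the booked densities is an exact transport of product
Haar, every `N`.**  Links `ι`, mask `p`; per active link `a` and frozen context `y`: a staple `S a y` (continuous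
in `y`); an eigenvalue map `f a y` (jointly MEASURABLE on context × spectrum, permutation
equivariant) given on the alcove by a map `G a y` sending `A` into `A` with
`HasJacobian (Leb|_A) (G a y) (JA a y)`; a kernel `h a y` following its recipe; and the BOOKED density `j a y ≥ 0` (no continuity), a symmetric jointly measurable function
`jD a y` (measurable) of the spectrum with
`jD a y(e^{ix(θ)}) · D(e^{ix(θ)}) = JA a y(θ) · D(e^{ix(G a y θ)})` on `A`.  Then
`Theory2.coupleFun p (u ↦ h a y (uS)(uS)⁻¹u)` has
`HasJacobian (⊗_ι Haar_{SU(3)}) _ (ofReal ∘ Theory2.coupleJac p (j at the loops))`. -/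
theorem hasJacobian_spectralCouplingLayer_sun_booked {ι : Type*} [Fintype ι]
    (p : ι → Prop) [DecidablePred p]
    (S : {i // p i} → ({i // ¬p i} → Matrix.specialUnitaryGroup (Fin (n + 1)) ℂ) → Matrix.specialUnitaryGroup (Fin (n + 1)) ℂ)
    (hS : ∀ a, Continuous (S a))
    (f : {i // p i} → ({i // ¬p i} → Matrix.specialUnitaryGroup (Fin (n + 1)) ℂ) → (Fin (n + 1) → ℂ) → (Fin (n + 1) → ℂ))
    (hfm : ∀ a, Measurable fun q : ({i // ¬p i} → Matrix.specialUnitaryGroup (Fin (n + 1)) ℂ) × (Fin (n + 1) → ℂ) => f a q.1 q.2)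
    (hfperm : ∀ a y (σ : Equiv.Perm (Fin (n + 1))) (d : Fin (n + 1) → ℂ), (∀ i, ‖d i‖ = 1) →
      f a y (fun i => d (σ i)) = fun i => f a y d (σ i))
    (G : {i // p i} → ({i // ¬p i} → Matrix.specialUnitaryGroup (Fin (n + 1)) ℂ) → (Fin n → ℝ) → (Fin n → ℝ))
    (JA : {i // p i} → ({i // ¬p i} → Matrix.specialUnitaryGroup (Fin (n + 1)) ℂ) → (Fin n → ℝ) → ℝ≥0∞)
    (hG : ∀ a y, HasJacobian ((volume : Measure (Fin n → ℝ)).restrict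
      {θ : Fin n → ℝ | StrictMono (Fin.snoc θ (-∑ k, θ k) : Fin (n + 1) → ℝ) ∧
        (Fin.snoc θ (-∑ k, θ k) : Fin (n + 1) → ℝ) (Fin.last n) <
          (Fin.snoc θ (-∑ k, θ k) : Fin (n + 1) → ℝ) 0 + 2 * π}) (G a y) (JA a y))
    (hGA : ∀ a y (θ : Fin n → ℝ), StrictMono (Fin.snoc θ (-∑ k, θ k) : Fin (n + 1) → ℝ) →
      (Fin.snoc θ (-∑ k, θ k) : Fin (n + 1) → ℝ) (Fin.last n) < (Fin.snoc θ (-∑ k, θ k) : Fin (n + 1) → ℝ) 0 + 2 * π →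
      StrictMono (Fin.snoc (G a y θ) (-∑ k, (G a y θ) k) : Fin (n + 1) → ℝ) ∧
          (Fin.snoc (G a y θ) (-∑ k, (G a y θ) k) : Fin (n + 1) → ℝ) (Fin.last n) <
            (Fin.snoc (G a y θ) (-∑ k, (G a y θ) k) : Fin (n + 1) → ℝ) 0 + 2 * π)
    (hfG : ∀ a y (θ : Fin n → ℝ), StrictMono (Fin.snoc θ (-∑ k, θ k) : Fin (n + 1) → ℝ) →
      (Fin.snoc θ (-∑ k, θ k) : Fin (n + 1) → ℝ) (Fin.last n) < (Fin.snoc θ (-∑ k, θ k) : Fin (n + 1) → ℝ) 0 + 2 * π →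
      f a y (fun i => (Circle.exp ((Fin.snoc θ (-∑ k, θ k) : Fin (n + 1) → ℝ) i) : ℂ)) =
        fun i => (Circle.exp ((Fin.snoc (G a y θ) (-∑ k, (G a y θ) k) : Fin (n + 1) → ℝ) i) : ℂ))
    (h : {i // p i} → ({i // ¬p i} → Matrix.specialUnitaryGroup (Fin (n + 1)) ℂ) →
      Matrix.specialUnitaryGroup (Fin (n + 1)) ℂ → Matrix.specialUnitaryGroup (Fin (n + 1)) ℂ)
    (hagree : ∀ a y (Q : Matrix.specialUnitaryGroup (Fin (n + 1)) ℂ) (V : Matrix (Fin (n + 1)) (Fin (n + 1)) ℂ) (d : Fin (n + 1) → ℂ),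
      V ∈ Matrix.unitaryGroup (Fin (n + 1)) ℂ → (Q : Matrix (Fin (n + 1)) (Fin (n + 1)) ℂ) = V * diagonal d * star V →
        ((h a y Q : Matrix.specialUnitaryGroup (Fin (n + 1)) ℂ) : Matrix (Fin (n + 1)) (Fin (n + 1)) ℂ) =
          V * diagonal (f a y d) * star V)
    (hf1 : ∀ a y (d : Fin (n + 1) → ℂ), (∀ i, ‖d i‖ = 1) → ∀ i, ‖f a y d i‖ = 1)
    (hfdet : ∀ a y (d : Fin (n + 1) → ℂ), (∀ i, ‖d i‖ = 1) → ∏ i, d i = 1 → ∏ i, f a y d i = 1)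
    (j : {i // p i} → ({i // ¬p i} → Matrix.specialUnitaryGroup (Fin (n + 1)) ℂ) →
      Matrix.specialUnitaryGroup (Fin (n + 1)) ℂ → ℝ)
    (hj0 : ∀ a y u, 0 ≤ j a y u)
    (jD : {i // p i} → ({i // ¬p i} → Matrix.specialUnitaryGroup (Fin (n + 1)) ℂ) → (Fin (n + 1) → ℂ) → ℝ)
    (hjDm : ∀ a, Measurable fun q : ({i // ¬p i} → Matrix.specialUnitaryGroup (Fin (n + 1)) ℂ) × (Fin (n + 1) → ℂ) => jD a q.1 q.2)
    (hjDperm : ∀ a y (σ : Equiv.Perm (Fin (n + 1))) (d : Fin (n + 1) → ℂ), jD a y (fun i => d (σ i)) = jD a y d)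
    (hjspec : ∀ a y (W : Matrix.specialUnitaryGroup (Fin (n + 1)) ℂ) (V : Matrix (Fin (n + 1)) (Fin (n + 1)) ℂ) (d : Fin (n + 1) → ℂ),
      V ∈ Matrix.unitaryGroup (Fin (n + 1)) ℂ → (W : Matrix (Fin (n + 1)) (Fin (n + 1)) ℂ) = V * diagonal d * star V →
        j a y W = jD a y d)
    (hjchart : ∀ a y (θ : Fin n → ℝ), StrictMono (Fin.snoc θ (-∑ k, θ k) : Fin (n + 1) → ℝ) →
      (Fin.snoc θ (-∑ k, θ k) : Fin (n + 1) → ℝ) (Fin.last n) < (Fin.snoc θ (-∑ k, θ k) : Fin (n + 1) → ℝ) 0 + 2 * π →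
      ENNReal.ofReal (jD a y (fun i => (Circle.exp ((Fin.snoc θ (-∑ k, θ k) : Fin (n + 1) → ℝ) i) : ℂ))) *
          ENNReal.ofReal ((∏ i, ∏ k ∈ Finset.univ.erase i,
            ‖(Circle.exp ((Fin.snoc θ (-∑ k, θ k) : Fin (n + 1) → ℝ) i) : ℂ) -
              (Circle.exp ((Fin.snoc θ (-∑ k, θ k) : Fin (n + 1) → ℝ) k) : ℂ)‖) / (Fintype.card (Fin (n + 1))).factorial) =
        JA a y θ * ENNReal.ofReal
          ((∏ i, ∏ k ∈ Finset.univ.erase i,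
            ‖(Circle.exp ((Fin.snoc (G a y θ) (-∑ k, (G a y θ) k) : Fin (n + 1) → ℝ) i) : ℂ) -
              (Circle.exp ((Fin.snoc (G a y θ) (-∑ k, (G a y θ) k) : Fin (n + 1) → ℝ) k) : ℂ)‖) /
                (Fintype.card (Fin (n + 1))).factorial)) :
    HasJacobian (Measure.pi fun _ : ι => haarProbability (Matrix.specialUnitaryGroup (Fin (n + 1)) ℂ))
      (Theory2.coupleFun p fun a y u => h a y (u * S a y) * (u * S a y)⁻¹ * u)
      fun U => ENNReal.ofReal (Theory2.coupleJac p (fun a y u => j a y (u * S a y)) U) := by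
  -- slices of the jointly measurable data
  have hfslice : ∀ a y, Measurable (f a y) := fun a y => (hfm a).comp (measurable_const.prodMk measurable_id)
  have hjDslice : ∀ a y, Measurable (jD a y) := fun a y => (hjDm a).comp (measurable_const.prodMk measurable_id)
  -- the torus maps and the booked torus densities, link by link
  have hexT : ∀ a y, ∃ fT : specialDiagonalTorus (Fin (n + 1)) → specialDiagonalTorus (Fin (n + 1)), ∀ t : specialDiagonalTorus (Fin (n + 1)),
      ((fT t : Matrix.specialUnitaryGroup (Fin (n + 1)) ℂ) : Matrix (Fin (n + 1)) (Fin (n + 1)) ℂ) =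
        diagonal (f a y fun i => ((t : Matrix.specialUnitaryGroup (Fin (n + 1)) ℂ) : Matrix (Fin (n + 1)) (Fin (n + 1)) ℂ) i i) :=
    fun a y => exists_torusMap_specialUnitary (hf1 a y) (hfdet a y)
  choose fT hfT using hexT
  have hex : ∀ a y, ∃ Jf : specialDiagonalTorus (Fin (n + 1)) → ℝ≥0∞, Measurable Jf ∧
      (∀ θ : Fin n → ℝ, StrictMono (Fin.snoc θ (-∑ k, θ k) : Fin (n + 1) → ℝ) →
      (Fin.snoc θ (-∑ k, θ k) : Fin (n + 1) → ℝ) (Fin.last n) < (Fin.snoc θ (-∑ k, θ k) : Fin (n + 1) → ℝ) 0 + 2 * π → Jf (E θ) = JA a y θ) ∧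
      (∀ σ t, Jf (P σ t) = Jf t) ∧
      ∀ (g : Matrix.specialUnitaryGroup (Fin (n + 1)) ℂ) (t : specialDiagonalTorus (Fin (n + 1))),
        ENNReal.ofReal (j a y (g * (t : Matrix.specialUnitaryGroup (Fin (n + 1)) ℂ) * g⁻¹)) * ENNReal.ofReal
            ((∏ i, ∏ k ∈ Finset.univ.erase i,
              ‖((t : Matrix.specialUnitaryGroup (Fin (n + 1)) ℂ) : Matrix (Fin (n + 1)) (Fin (n + 1)) ℂ) i i -
                ((t : Matrix.specialUnitaryGroup (Fin (n + 1)) ℂ) : Matrix (Fin (n + 1)) (Fin (n + 1)) ℂ) k k‖) / (Fintype.card (Fin (n + 1))).factorial) =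
          Jf t * ENNReal.ofReal
            ((∏ i, ∏ k ∈ Finset.univ.erase i,
              ‖((fT a y t : Matrix.specialUnitaryGroup (Fin (n + 1)) ℂ) : Matrix (Fin (n + 1)) (Fin (n + 1)) ℂ) i i -
                ((fT a y t : Matrix.specialUnitaryGroup (Fin (n + 1)) ℂ) : Matrix (Fin (n + 1)) (Fin (n + 1)) ℂ) k k‖) /
                  (Fintype.card (Fin (n + 1))).factorial) := by
    intro a y
    exact exists_torusDensity_sun_booked hE hP (hfslice a y) (hfperm a y) (hGA a y) (hfG a y) (hfT a y)
      (JD := fun d => ENNReal.ofReal (jD a y d)) (ENNReal.measurable_ofReal.comp (hjDslice a y))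
      (fun σ d => by simp only [hjDperm]) (hjchart a y)
      (J := fun W => ENNReal.ofReal (j a y W)) (fun W V d hV hW => by simp only [hjspec a y W V d hV hW])
  choose JfT hJfTm hJA hJinv hJ using hex
  have hfJ : ∀ a y, HasJacobian (haarProbability (specialDiagonalTorus (Fin (n + 1)))) (fT a y) (JfT a y) := by
    intro a y
    exact hasJacobian_sunTorus_of_alcoveMap hE hP (hG a y) (measurable_torusMap_of_measurable (hfslice a y) (hfT a y))
      (hJfTm a y) (fun θ h0 h1 => torusMap_angleChart_sun hE (hfT a y) (hfG a y θ h0 h1)) (hJA a y)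
      (fun σ t => torusMap_permDiag (hP σ) (hfperm a y σ) (hfT a y) t) (hJinv a y)
  exact hasJacobian_spectralCouplingLayer_specialUnitary_of_measurable p S hS f hfm h hagree fT hfT JfT hfJ j hj0
    jD hjDm hjspec hJ

end SUN

end Summit.Ventures.LatticeQCDFlow.Exactness
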